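/-
Copyright (c) 2026. All rights reserved.
Released under Apache 2.0 license as described in the file LICENSE.
Authors: abc-iut cell, campaign-S prover seat abc-iut-S5 (wave 2).
-/
import Mathlib.LinearAlgebra.PiTensorProduct.Basis
import Literature.IUT.LogVolume.TensorPacketLemmas
import Literature.IUT.LogVolume.IntegralBases
import HarnessLib

/-!
# Pure tensors, integrality and integral bases for the tensor packet ring `R_I` ([IUTchIV] Prop. 1.1)

Mochizuki, *Inter-universal Teichmüller theory IV*, RIMS manuscript (Apr. 2020), §1, Proposition 1.1,
kurims p. 9.  PROOF INFRASTRUCTURE for the discharge of Prop. 1.1 / 1.2 (ii)–(iv) (file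
`TensorPacketRingProofs.lean`) over the cell's REAL definitions of `TensorPacketRing.lean`
(`PacketAlgebra = V = ⊗_{ℚ_p} k_i`, `integerPacket = R_I`, `normalizedPacket = (R_I)^∼`,
`purePacket`, `iota`, `ppow`):

* algebra of pure tensors beyond the shared base `TensorPacketLemmas.lean` (abc-iut-S6:
  `purePacket_mul`, `iota_eq_purePacket`, `ppow_*`, `*_mem_integerPacket`, `integerPacket_induction`):
  `iota_mul_purePacket`, `smul_purePacket` (one slot), `ppow_mul_purePacket`, `ppow_eq_iota`,
  `purePacket_eq_prod_iota`, `purePacket_mul_inv`, `integerPacket_le_of_forall_purePacket_mem`;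
* `R_I` is integral over `ℤ_p`, hence so is `(R_I)^∼` (`isIntegral_of_mem_integerPacket`,
  `isIntegral_of_mem_normalizedPacket`); conversely `(R_I)^∼` is exactly the integral closure of `ℤ_p`
  in `V` (`mem_normalizedPacket_iff_isIntegral`);
* over integral bases (`IntegralBases.lean`) — the modelling identification "`⊗_{ℤ_p} R_i → V` is
  injective with image the span of the pure tensors" owed by `TensorPacketRing.lean` — **`R_I` is exactly
  the set of elements of `V` whose coordinates in the tensor basis `⊗_i b^{(i)}` (Mathlib
  `Basis.piTensorProduct`) lie in `ℤ_p`** (`norm_repr_le_of_mem_integerPacket`,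
  `mem_integerPacket_of_norm_repr_le`), and `R_I ⊗ ℚ_p = V` (`span_integerPacket_eq_top'`).

Classical multilinear algebra; nothing disputed (the tags record the cell's typing of [IUTchIV]).
-/

noncomputable section

open Metric Set Function Module
open scoped Pointwise TensorProduct NormedField

namespace Literature.IUT.LogVolume

variable (p : ℕ) [Fact p.Prime]
variable {I : Type}
variable (k : I → Type) [∀ i, NontriviallyNormedField (k i)] [∀ i, NormedAlgebra ℚ_[p] (k i)]

/-! ## Pure tensors -/

/-- `ι_i(a) · (⊗ x_j) = ⊗ x'_j` with `x'_i = a x_i`, `x'_j = x_j` (`j ≠ i`).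
[claim: Mochizuki2012, status: disputed] -/
theorem iota_mul_purePacket [DecidableEq I] (i : I) (a : k i) (x : Π i, k i) :
    iota p k i a * purePacket p k x = purePacket p k (update x i (a * x i)) := by
  rw [iota_eq_purePacket, purePacket_mul]
  congr 1
  ext j
  by_cases h : j = i
  · subst h; simp
  · simp [h]

/-- `⊗ x_i = ∏_i ι_i(x_i)`. [claim: Mochizuki2012, status: disputed] -/
theorem purePacket_eq_prod_iota [Fintype I] [DecidableEq I] (x : Π i, k i) : purePacket p k x = ∏ i, iota p k i (x i) := by
  simp_rw [iota_eq_purePacket, purePacket]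
  rw [← PiTensorProduct.tprod_prod, Finset.univ_prod_mulSingle]

/-- Scalars move into any slot: `c · (⊗ x_j) = ⊗ x'_j`, `x'_i = c x_i`. [claim: Mochizuki2012, status: disputed] -/
theorem smul_purePacket [DecidableEq I] (i : I) (c : ℚ_[p]) (x : Π i, k i) :
    c • purePacket p k x = purePacket p k (update x i (c • x i)) := by
  have h := (PiTensorProduct.tprod ℚ_[p] (s := k)).map_update_smul x i c (x i)
  rw [update_eq_self] at h
  exact h.symm

/-- `p^n · (⊗ x_j) = ⊗ x'_j` with `x'_i = p^n x_i`. [claim: Mochizuki2012, status: disputed] -/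
theorem ppow_mul_purePacket [DecidableEq I] (n : ℤ) (i : I) (x : Π i, k i) :
    ppow p k n * purePacket p k x = purePacket p k (update x i ((p : k i) ^ n * x i)) := by
  rw [ppow, ← Algebra.smul_def, smul_purePacket p k i, Algebra.smul_def, map_zpow₀, map_natCast]

/-- `p^n = ι_i(p^n)` for any slot `i`. [claim: Mochizuki2012, status: disputed] -/
theorem ppow_eq_iota [DecidableEq I] (n : ℤ) (i : I) : ppow p k n = iota p k i ((p : k i) ^ n) := by
  have := ppow_mul_purePacket p k n i 1
  rw [purePacket_one, mul_one] at this
  rw [this, iota_eq_purePacket]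
  congr 1
  ext j
  by_cases h : j = i
  · subst h; simp
  · simp [h]

/-- A pure tensor of nonzero elements is invertible: `(⊗ x_i)(⊗ x_i⁻¹) = 1`.
[claim: Mochizuki2012, status: disputed] -/
theorem purePacket_mul_inv {x : Π i, k i} (hx : ∀ i, x i ≠ 0) :
    purePacket p k x * purePacket p k x⁻¹ = 1 := by
  rw [purePacket_mul, ← purePacket_one p k]
  congr 1
  ext i
  simp [hx i]

/-! ## Membership in `R_I` -/

/-- `ι_i(a) ∈ R_I` for `‖a‖ ≤ 1`. [claim: Mochizuki2012, status: disputed] -/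
theorem iota_mem_integerPacket [DecidableEq I] (i : I) {a : k i} (ha : ‖a‖ ≤ 1) : iota p k i a ∈ integerPacket p k := by
  rw [iota_eq_purePacket]
  refine purePacket_mem_integerPacket p k fun j => ?_
  by_cases h : j = i
  · subst h; simpa using ha
  · simp [h]

/-- `R_I` is the additive group generated by the integer pure tensors (they form a multiplicative
monoid), so an additive subgroup containing them contains `R_I`. [claim: Mochizuki2012, status: disputed] -/
theorem integerPacket_le_of_forall_purePacket_mem {H : AddSubgroup (PacketAlgebra p k)}
    (hH : ∀ x : Π i, k i, (∀ i, ‖x i‖ ≤ 1) → purePacket p k x ∈ H) :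
    (integerPacket p k).toAddSubgroup ≤ H := by
  let M : Submonoid (PacketAlgebra p k) :=
    { carrier := {t | ∃ x : Π i, k i, (∀ i, ‖x i‖ ≤ 1) ∧ t = purePacket p k x}
      mul_mem' := by
        rintro _ _ ⟨x, hx, rfl⟩ ⟨y, hy, rfl⟩
        refine ⟨x * y, fun i => ?_, (purePacket_mul p k x y)⟩
        rw [Pi.mul_apply, norm_mul]
        exact mul_le_one₀ (hx i) (norm_nonneg _) (hy i)
      one_mem' := ⟨1, fun i => by simp, (purePacket_one p k).symm⟩ }
  intro v hv
  have hv' : v ∈ Subring.closure (M : Set (PacketAlgebra p k)) := hv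
  rw [Subring.mem_closure_iff, Submonoid.closure_eq] at hv'
  refine (AddSubgroup.closure_le _).mpr ?_ hv'
  rintro _ ⟨x, hx, rfl⟩
  exact hH x hx

/-! ## `R_I` and `(R_I)^∼` are integral over `ℤ_p` -/

/-- Integrality over a subring passes to any larger subring. [claim: Mochizuki2012, status: disputed] -/
theorem isIntegral_of_subring_le {V : Type*} [CommRing V] {S S' : Subring V} (h : S ≤ S') {z : V}
    (hz : IsIntegral S z) : IsIntegral S' z := by
  obtain ⟨f, hf, hfz⟩ := hz
  refine ⟨f.map (Subring.inclusion h), hf.map _, ?_⟩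
  rw [Polynomial.eval₂_map]
  exact hfz

section Integral

variable [Fintype I] [∀ i, IsUltrametricDist (k i)] [∀ i, ProperSpace (k i)]

omit [Fintype I] in
/-- `ι_i(a)` is integral over `ℤ_p` for `a ∈ 𝒪_{k_i}`. [claim: Mochizuki2012, status: disputed] -/
theorem isIntegral_iota [DecidableEq I] (i : I) {a : k i} (ha : ‖a‖ ≤ 1) : IsIntegral ℤ_[p] (iota p k i a) := by
  have h : IsIntegral ℤ_[p] a := (norm_le_one_iff_isIntegral p (k i) a).mp ha
  exact h.map ((iota p k i).restrictScalars ℤ_[p])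

/-- Integer pure tensors are integral over `ℤ_p`. [claim: Mochizuki2012, status: disputed] -/
theorem isIntegral_purePacket {x : Π i, k i} (hx : ∀ i, ‖x i‖ ≤ 1) :
    IsIntegral ℤ_[p] (purePacket p k x) := by
  classical
  rw [purePacket_eq_prod_iota]
  exact IsIntegral.prod _ fun i _ => isIntegral_iota p k i (hx i)

/-- `R_I` is contained in the integral closure of `ℤ_p` in `V`. [claim: Mochizuki2012, status: disputed] -/
theorem integerPacket_le_integralClosure :
    integerPacket p k ≤ (integralClosure ℤ_[p] (PacketAlgebra p k)).toSubring :=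
  Subring.closure_le.mpr (by
    rintro _ ⟨x, hx, rfl⟩
    exact isIntegral_purePacket p k hx)

/-- **`R_I` is integral over `ℤ_p`.** [claim: Mochizuki2012, status: disputed] -/
theorem isIntegral_of_mem_integerPacket {v : PacketAlgebra p k} (hv : v ∈ integerPacket p k) :
    IsIntegral ℤ_[p] v :=
  integerPacket_le_integralClosure p k hv

/-- **`(R_I)^∼` is integral over `ℤ_p`** (integral over `R_I`, which is integral over `ℤ_p`).
[claim: Mochizuki2012, status: disputed] -/
theorem isIntegral_of_mem_normalizedPacket {v : PacketAlgebra p k} (hv : v ∈ normalizedPacket p k) :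
    IsIntegral ℤ_[p] v := by
  have h1 : IsIntegral (integerPacket p k) v := hv
  have h2 : IsIntegral (integralClosure ℤ_[p] (PacketAlgebra p k)).toSubring v :=
    isIntegral_of_subring_le (integerPacket_le_integralClosure p k) h1
  have h3 : IsIntegral (integralClosure ℤ_[p] (PacketAlgebra p k)) v := h2
  exact isIntegral_trans v h3

omit [Fintype I] [∀ i, IsUltrametricDist (k i)] [∀ i, ProperSpace (k i)] in
/-- `(R_I)^∼` is a subring: products stay inside. [claim: Mochizuki2012, status: disputed] -/
theorem mul_mem_normalizedPacket {v w : PacketAlgebra p k} (hv : v ∈ normalizedPacket p k)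
    (hw : w ∈ normalizedPacket p k) : v * w ∈ normalizedPacket p k :=
  mul_mem hv hw

omit [Fintype I] [∀ i, IsUltrametricDist (k i)] [∀ i, ProperSpace (k i)] in
/-- An element of `V` integral over `ℤ_p` is integral over `R_I ⊇ ℤ_p` (nonempty `I`), i.e. lies in
`(R_I)^∼`. [claim: Mochizuki2012, status: disputed] -/
theorem mem_normalizedPacket_of_isIntegral [Nonempty I] {v : PacketAlgebra p k}
    (hv : IsIntegral ℤ_[p] v) : v ∈ normalizedPacket p k := by
  classical
  obtain ⟨f, hf, hfv⟩ := hv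
  -- `ℤ_p → V` lands in `R_I`
  let φ : ℤ_[p] →+* integerPacket p k :=
    (algebraMap ℤ_[p] (PacketAlgebra p k)).codRestrict (integerPacket p k) fun c => by
      rw [IsScalarTower.algebraMap_apply ℤ_[p] ℚ_[p] (PacketAlgebra p k)]
      exact algebraMap_mem_integerPacket p k (by rw [PadicInt.algebraMap_apply]; exact c.2)
  change IsIntegral (integerPacket p k) v
  refine ⟨f.map φ, hf.map φ, ?_⟩
  rw [Polynomial.eval₂_map]
  exact hfv

/-- **`(R_I)^∼` is the integral closure of `ℤ_p` in `V`** (nonempty `I`): `v ∈ (R_I)^∼ ↔ v` is integral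
over `ℤ_p`.  Hence, under ANY `ℚ_p`-algebra isomorphism `V ≅ ∏_j L_j` with fields `L_j` ("tensor products
decompose as direct sums", [IUTchIV] Prop. 1.1 proof / Prop. 1.4 (i)), `(R_I)^∼` corresponds to
`∏_j 𝒪_{L_j}` — the second modelling identification owed by `TensorPacketRing.lean`.
[claim: Mochizuki2012, status: disputed] -/
theorem mem_normalizedPacket_iff_isIntegral [Nonempty I] {v : PacketAlgebra p k} :
    v ∈ normalizedPacket p k ↔ IsIntegral ℤ_[p] v :=
  ⟨isIntegral_of_mem_normalizedPacket p k, mem_normalizedPacket_of_isIntegral p k⟩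

end Integral


/-! ## The tensor basis and the coordinate description of `R_I` -/

section PacketBasis

variable [Fintype I] [∀ i, IsUltrametricDist (k i)]
variable {p k}
variable {κ : I → Type} [∀ i, Fintype (κ i)]
  (bZ : Π i, Basis (κ i) ℤ_[p] (Valued.integer (k i))) (bQ : Π i, Basis (κ i) ℚ_[p] (k i))
  (hb : ∀ i j, bQ i j = (bZ i j : k i))
include hb

/-- Integer pure tensors have tensor-basis coordinates of norm `≤ 1` (the coordinate of `⊗ x_i` at
`J` is `∏_i` (coordinate of `x_i` at `J_i`)). [claim: Mochizuki2012, status: disputed] -/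
theorem norm_repr_purePacket_le {x : Π i, k i} (hx : ∀ i, ‖x i‖ ≤ 1) (J : Π i, κ i) :
    ‖(Basis.piTensorProduct bQ).repr (purePacket p k x) J‖ ≤ 1 := by
  rw [purePacket, Basis.piTensorProduct_repr_tprod_apply, norm_prod]
  exact Finset.prod_le_one (fun i _ => norm_nonneg _)
    fun i _ => norm_repr_le_one (bZ i) (bQ i) (hb i) (hx i) (J i)

/-- **`R_I ⊆ {integral coordinates}`**: every element of `R_I` has tensor-basis coordinates in `ℤ_p`
(the set of such elements is a subring containing the integer pure tensors).
[claim: Mochizuki2012, status: disputed] -/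
theorem norm_repr_le_of_mem_integerPacket {v : PacketAlgebra p k} (hv : v ∈ integerPacket p k)
    (J : Π i, κ i) : ‖(Basis.piTensorProduct bQ).repr v J‖ ≤ 1 := by
  classical
  set B := Basis.piTensorProduct bQ with hB
  let T : Subring (PacketAlgebra p k) :=
    { carrier := {v | ∀ J, ‖B.repr v J‖ ≤ 1}
      mul_mem' := by
        intro v w hv hw L
        have hvw : v * w = ∑ J, ∑ J', (B.repr v J * B.repr w J') • (B J * B J') := by
          conv_lhs => rw [← B.sum_repr v, ← B.sum_repr w]
          rw [Finset.sum_mul_sum]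
          refine Finset.sum_congr rfl fun J _ => Finset.sum_congr rfl fun J' _ => ?_
          rw [smul_mul_smul_comm]
        rw [hvw, map_sum]
        simp only [map_sum, map_smul, Finsupp.coe_finsetSum, Finsupp.coe_smul, Finset.sum_apply,
          Pi.smul_apply, smul_eq_mul]
        refine IsUltrametricDist.norm_sum_le_of_forall_le_of_nonneg zero_le_one fun J _ => ?_
        refine IsUltrametricDist.norm_sum_le_of_forall_le_of_nonneg zero_le_one fun J' _ => ?_
        rw [norm_mul, norm_mul]
        have hJJ' : ‖B.repr (B J * B J') L‖ ≤ 1 := by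
          rw [hB, Basis.piTensorProduct_apply, Basis.piTensorProduct_apply, ← purePacket, ← purePacket,
            purePacket_mul, ← hB]
          exact norm_repr_purePacket_le bZ bQ hb (fun i => by
            rw [Pi.mul_apply, norm_mul]
            exact mul_le_one₀ (norm_basis_le_one (bZ i) (bQ i) (hb i) _) (norm_nonneg _)
              (norm_basis_le_one (bZ i) (bQ i) (hb i) _)) L
        exact mul_le_one₀ (mul_le_one₀ (hv J) (norm_nonneg _) (hw J')) (norm_nonneg _) hJJ'
      one_mem' := by
        intro J
        rw [show (1 : PacketAlgebra p k) = purePacket p k 1 from rfl]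
        exact norm_repr_purePacket_le bZ bQ hb (fun i => by simp) J
      add_mem' := by
        intro v w hv hw J
        rw [map_add, Finsupp.add_apply]
        exact (IsUltrametricDist.norm_add_le_max _ _).trans (max_le (hv J) (hw J))
      zero_mem' := by intro J; simp
      neg_mem' := by
        intro v hv J
        rw [map_neg, Finsupp.neg_apply, norm_neg]
        exact hv J }
  have hle : integerPacket p k ≤ T := Subring.closure_le.mpr (by
    rintro _ ⟨x, hx, rfl⟩ J
    exact norm_repr_purePacket_le bZ bQ hb hx J)
  exact hle hv J

/-- **`{integral coordinates} ⊆ R_I`** (nonempty `I`): an element of `V` all of whose tensor-basis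
coordinates lie in `ℤ_p` belongs to `R_I`.  With the previous lemma: `R_I = ⊕_J ℤ_p · (⊗_i b^{(i)}_{J_i})`,
i.e. `⊗_{ℤ_p} R_i → V` is injective with image `R_I`. [claim: Mochizuki2012, status: disputed] -/
theorem mem_integerPacket_of_norm_repr_le [Nonempty I] {v : PacketAlgebra p k}
    (h : ∀ J, ‖(Basis.piTensorProduct bQ).repr v J‖ ≤ 1) : v ∈ integerPacket p k := by
  classical
  rw [← (Basis.piTensorProduct bQ).sum_repr v]
  refine sum_mem fun J _ => smul_mem_integerPacket p k (h J) ?_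
  rw [Basis.piTensorProduct_apply]
  exact purePacket_mem_integerPacket p k fun i => norm_basis_le_one (bZ i) (bQ i) (hb i) (J i)

omit [∀ i, Fintype (κ i)] in
/-- **`R_I ⊗ ℚ_p = V`**: `R_I` spans `V` over `ℚ_p` (the tensor basis of integral bases lies in `R_I`), i.e.
`V` is the ring of fractions `R_I[1/p]` of `R_I` in which [IUTchIV] Prop. 1.1 takes the normalisation.
[claim: Mochizuki2012, status: disputed] -/
theorem span_integerPacket_eq_top :
    Submodule.span ℚ_[p] (integerPacket p k : Set (PacketAlgebra p k)) = ⊤ := by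
  rw [eq_top_iff, ← (Basis.piTensorProduct bQ).span_eq, Submodule.span_le]
  rintro _ ⟨J, rfl⟩
  rw [Basis.piTensorProduct_apply]
  exact Submodule.subset_span
    (purePacket_mem_integerPacket p k fun i => norm_basis_le_one (bZ i) (bQ i) (hb i) (J i))

end PacketBasis

/-- **`V = R_I ⊗_{ℤ_p} ℚ_p`** ([IUTchIV] Prop. 1.1 / 1.2: "`log_p(R_I^×) ⊗ ℚ_p`", the ring of fractions of
`R_I`): the `ℚ_p`-span of `R_I` is all of `V`. [claim: Mochizuki2012, status: disputed] -/
theorem span_integerPacket_eq_top' [Fintype I] [∀ i, IsUltrametricDist (k i)] [∀ i, ProperSpace (k i)] :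
    Submodule.span ℚ_[p] (integerPacket p k : Set (PacketAlgebra p k)) = ⊤ := by
  have hbases := fun i => exists_integralBasis (p := p) (k i)
  choose n bZ bQ hb using hbases
  exact span_integerPacket_eq_top bZ bQ hb

end Literature.IUT.LogVolume

end
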